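import Summits.QuantumFields.YangMills.Theorems.UnitScaleTiltProp7SigmaIdentityComb
import Summits.QuantumFields.YangMills.Theorems.UnitScaleTiltProp7SymAvgTwSymDefs
import Literature.MathematicalPhysics.QuantumFieldTheory.Balaban1983to89.B9Eq39Adjoint
import HarnessLib

/-!
# Route `UnitScaleTilt`, crux K1 «MinimiserStabilityRegPr» (stmt-QuantumFields-19200) — ARCHITECTURE (A′) ON Σ: **THE P-A2 ASSEMBLER DOOR** — the `ℓ¹` comb-remainder binder
# `hPA2` of ✓`Prop7CmapTwSupRow.hcoS_of_normG0_of_combRemainderL1Rows` from THREE INDEPENDENT MEMBER ROWS in the X-letters of record: (S) the symmetric chain's `ℓ¹` bound on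
# `Σ_ĉ‖C_S(W,iX)ĉ‖`, (β) the comb–sym difference `Σ_ĉ‖C(W,iX)ĉ − C_S(W,iX)ĉ‖`, (DV) the crude divergence slice — and the E2E `hcoS` over them

Cell `ym3-torus` ∕ fleet seat `ym-ust-19200-p1` (gen 18, route-R E′ growth-side lead ∕ namer).  THEOREMS ONLY (0 `def`, 0 `sorry`); `--supports stmt-QuantumFields-19200`, count-neutral.
YM₃ on T³ is a ladder rung (R3), not the Clay problem; nothing here claims the stub, the crux, `hcoS`, d = 4 or the mass gap — (S), (β), (DV) are DISPLAYED hypotheses.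

WHY (E2E-SIGMA-SPEC; WORDS of 2026-08-29 04:5xZ).  The P-A2 binder `Σ_ĉ‖C(W,iX)ĉ‖ ≤ C₁ℓ⁻¹M + C₂ℓ(K + dv)`, `dv ≤ ζK + δ₁ℓ⁻²M` is supplied by three groups of seats in one
common currency — `M = Σ_b‖X b‖²`, the door's plaquette energy `K = Σ_p‖ℒ_p(iX)‖²`, and the LATTICE divergence square `DIV = Σ_x Σ_{jk} |(divB_W (iX))(x)_{jk}|²` (lit-balaban's `divB ∕ torusT`,
the letter of ★routeR-w4 ✓`divHS_pertVar_le` and of ★px12 ✓`sum_normSq_divB_smul_I_le_of_memberDivSq`): (S) = the SYMMETRIC chain (★px18 F0″, ★routeR-w6∕px15 F1″, ★routeR-w3 F2″ ✓p697009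
`l1_CmapTwS_le_damped_levelMasses_damped`, ★px17 F3″ `hM`, `jointRow_of_levelMasses_q`, ★routeR-w4 ✓p695503 exchange); (β) = the comb–sym DIFFERENCE (★px18 ✓p695591 BCH door, ★px16 R12-door + R0,
★routeR-w2 ✓`QTw_sub_QTwS_apply_eq`); (DV) = P-A4 (★px19 HCOMP-KNIT ∘ ★px12 ✓`div_sq_le_of_competitorRow` ∘ ✓DV-SEAM, `ζ = 0`).  This door adds them: `‖C ĉ‖ ≤ ‖C_S ĉ‖ + ‖C ĉ − C_S ĉ‖`
(`norm_le_insert'`), `C₁ := CS₁ + CD₁`, `C₂ := CS₂ + CD₂`, `dv := DIV`, radius `min(eS, eD, eV)` — so each group lands its LAST line against its own row here, by `exact`, independently.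

WHAT IS PROVED (ns `…Theorems.Prop7PA2OfSymDiffDivRows`): ★★★ `hPA2_of_symL1_diffL1_divSlice` — rows (S) `hS`, (β) `hD`, (DV) `hV` (each: per `(L, B₁′)` an L-only radius and nonnegative L-only constants, then
the bound on the `hcoS` binder VERBATIM) ⊢ the `hPA2` hypothesis of ✓`hcoS_of_normG0_of_combRemainderL1Rows` TOKEN FOR TOKEN (the `hcoS` corollary over (N06) ∧ (S) ∧ (β) ∧ (DV) is the sibling file
`UnitScaleTiltProp7HcoSOfSymDiffDivRows`; this door imports only the chart letters so that every supplier can import it cheaply).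
HONEST SCOPE.  Triangle inequality + bookkeeping over landed theorems; the four analytic rows are displayed; nothing of print asserted; rung R3, not Clay; YM gap NOT proved.

References: T. Bałaban, CMP 102 (1985) 277–309 [Balaban1985Variational] ((44)–(47) pp.285–286, (106)–(111) p.294, (141)–(142) p.299); CMP 98 (1985) 17–51 [Balaban1985Averaging]
((89)–(92) p.31, (125)–(127) p.36); CMP 99 (1985) 389–434 [Balaban1985BackgroundPropagators] ((3.14) p.393, Thm 3.11 p.416); CMP 99 (1985) 75–102 [Balaban1985RegularSpaces] ((1.9) p.77).
-/

set_option autoImplicit false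
noncomputable section

open scoped BigOperators Matrix.Norms.L2Operator Matrix Topology InnerProductSpace
open Filter NormedSpace

namespace Summit.QuantumFields.YangMills.Theorems.Prop7PA2OfSymDiffDivRows

open Literature.MathematicalPhysics.QuantumFieldTheory.Balaban1983to89
open Literature.MathematicalPhysics.QuantumFieldTheory.Balaban1983to89.T3ContinuumYM3Torus
open Literature.MathematicalPhysics.QuantumFieldTheory.Balaban1983to89.T3UnitLawDensityEML (ℰp)
open Literature.MathematicalPhysics.QuantumFieldTheory.Balaban1983to89.T3ConstrainedMinimiser (fibre)
open Literature.MathematicalPhysics.QuantumFieldTheory.Balaban1983to89.T3PrintedRegularMinimiser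
open Literature.MathematicalPhysics.QuantumFieldTheory.Balaban1983to89.T3RegularMinimiser
open Literature.MathematicalPhysics.QuantumFieldTheory.Balaban1983to89.T3Thm1Carrier
open T4Continuum BlockAveraging AveragingRT ExpMeanLog BlockAveragingEMLLinearised BlockAveragingEMLLinearisedBackground BlockAveragingEMLProp2
open B10Eq27TorusAxialLog (pull unitsField toUField)
open B9Eq39Adjoint (divB)
open B9TorusCalculus (torusT)
open T3SectALandauChart (emb15 eta eta_pos bgUnits In19)
open Summit.QuantumFields.YangMills.Theorems.Prop7SPrint (basePt RestrictedPrint AvgCondPrint IsLandauPrint)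
open Summit.QuantumFields.YangMills.Theorems.Prop7TPrint (expHermField)
open Summit.QuantumFields.YangMills.Theorems.Prop7SymAvgTw (QTw CmapTw)
open Summit.QuantumFields.YangMills.Theorems.Prop7SymAvgTwSym (CmapTwS)

/-! ## §1 The assembler -/

/-- ★★★ **THE P-A2 ASSEMBLER DOOR**: (S) the symmetric chain's `ℓ¹` row, (β) the comb–sym difference row and (DV) the crude divergence slice — each per `(L, B₁′)` with its own L-only radius
and nonnegative L-only constants, on the `hcoS` binder — give the `hPA2` hypothesis of ✓`hcoS_of_normG0_of_combRemainderL1Rows` TOKEN FOR TOKEN (`C₁ := CS₁ + CD₁`, `C₂ := CS₂ + CD₂`,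
`dv := DIV`, radius `min(eS, eD, eV)`; `‖C ĉ‖ ≤ ‖C_S ĉ‖ + ‖C ĉ − C_S ĉ‖`).
[cite: Balaban1985Variational, (44)-(47) pp.285-286, (106)-(111) p.294; Balaban1985Averaging, (89)-(92) p.31, (125)-(127) p.36; Balaban1985RegularSpaces, (1.9) p.77] -/
theorem hPA2_of_symL1_diffL1_divSlice
    (hS : ∀ (L : ℕ), 1 < L → ∀ (B₁' : ℝ), 0 < B₁' → ∃ eS CS₁ CS₂ : ℝ, 0 < eS ∧ 0 ≤ CS₁ ∧ 0 ≤ CS₂ ∧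
      ∀ (F : T3Family), F.L = L → ∀ (n K : ℕ) (hnK : n < K) (e : ℝ) (V : GaugeField (F.P n) 0 (Matrix.specialUnitaryGroup (Fin 2) ℂ))
        (W : GaugeField (F.P K) 0 (Matrix.specialUnitaryGroup (Fin 2) ℂ)) (X : PBond (F.P K) 0 → Matrix (Fin 2) (Fin 2) ℂ),
        0 < e → e ≤ eS → W ∈ regFibrePr F n K hnK.le e V →
        (∀ γ : ℝ → GaugeField (F.P K) 0 (Matrix.specialUnitaryGroup (Fin 2) ℂ), γ 0 = W → (∀ t, γ t ∈ fibre F ℰp n K hnK.le V) →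
          (∀ b, DifferentiableAt ℝ (fun t => ((γ t b : Matrix.specialUnitaryGroup (Fin 2) ℂ) : Matrix (Fin 2) (Fin 2) ℂ)) 0) →
            deriv (fun t => wilsonAction4 (γ t)) 0 = 0) →
        In19 F n K (2 * B₁' * e) W (expHermField X) X → AvgCondPrint F n K hnK.le V W X → IsLandauPrint F n K W X →
          ∑ ĉ : PBond (F.P n) 0, ‖CmapTwS F n K hnK.le W (fun b => Complex.I • X b) ĉ‖
              ≤ CS₁ * ((F.L : ℝ) ^ (K - n))⁻¹ * (∑ b : PBond (F.P K) 0, ‖X b‖ ^ 2) + CS₂ * ((F.L : ℝ) ^ (K - n)) * ((∑ p : Plaq (F.P K) 0, ‖((Complex.I • X ⟨p.src, p.μ⟩) + ((W ⟨p.src, p.μ⟩ : Matrix (Fin 2) (Fin 2) ℂ) * (Complex.I • X ⟨p.src.shift p.μ, p.ν⟩) * star (W ⟨p.src, p.μ⟩ : Matrix (Fin 2) (Fin 2) ℂ))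
            - (((W ⟨p.src, p.μ⟩ * W ⟨p.src.shift p.μ, p.ν⟩ * (W ⟨p.src.shift p.ν, p.μ⟩)⁻¹ : Matrix.specialUnitaryGroup (Fin 2) ℂ) : Matrix (Fin 2) (Fin 2) ℂ) * (Complex.I • X ⟨p.src.shift p.ν, p.μ⟩) * star ((W ⟨p.src, p.μ⟩ * W ⟨p.src.shift p.μ, p.ν⟩ * (W ⟨p.src.shift p.ν, p.μ⟩)⁻¹ : Matrix.specialUnitaryGroup (Fin 2) ℂ) : Matrix (Fin 2) (Fin 2) ℂ))
            - (((GaugeField.plaqHol W p : Matrix.specialUnitaryGroup (Fin 2) ℂ) : Matrix (Fin 2) (Fin 2) ℂ) * (Complex.I • X ⟨p.src, p.ν⟩) * star ((GaugeField.plaqHol W p : Matrix.specialUnitaryGroup (Fin 2) ℂ) : Matrix (Fin 2) (Fin 2) ℂ)))‖ ^ 2) + (∑ x : Site (F.P K) 0, ∑ j : Fin 2, ∑ k : Fin 2,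
              ‖(divB (torusT (F.P K) 0) (fun κ z => unitsField (toUField W) ⟨z, κ⟩) (fun κ z => Complex.I • X ⟨z, κ⟩) x) j k‖ ^ 2)))
    (hD : ∀ (L : ℕ), 1 < L → ∀ (B₁' : ℝ), 0 < B₁' → ∃ eD CD₁ CD₂ : ℝ, 0 < eD ∧ 0 ≤ CD₁ ∧ 0 ≤ CD₂ ∧
      ∀ (F : T3Family), F.L = L → ∀ (n K : ℕ) (hnK : n < K) (e : ℝ) (V : GaugeField (F.P n) 0 (Matrix.specialUnitaryGroup (Fin 2) ℂ))
        (W : GaugeField (F.P K) 0 (Matrix.specialUnitaryGroup (Fin 2) ℂ)) (X : PBond (F.P K) 0 → Matrix (Fin 2) (Fin 2) ℂ),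
        0 < e → e ≤ eD → W ∈ regFibrePr F n K hnK.le e V →
        (∀ γ : ℝ → GaugeField (F.P K) 0 (Matrix.specialUnitaryGroup (Fin 2) ℂ), γ 0 = W → (∀ t, γ t ∈ fibre F ℰp n K hnK.le V) →
          (∀ b, DifferentiableAt ℝ (fun t => ((γ t b : Matrix.specialUnitaryGroup (Fin 2) ℂ) : Matrix (Fin 2) (Fin 2) ℂ)) 0) →
            deriv (fun t => wilsonAction4 (γ t)) 0 = 0) →
        In19 F n K (2 * B₁' * e) W (expHermField X) X → AvgCondPrint F n K hnK.le V W X → IsLandauPrint F n K W X →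
          ∑ ĉ : PBond (F.P n) 0, ‖CmapTw F n K hnK.le W (fun b => Complex.I • X b) ĉ - CmapTwS F n K hnK.le W (fun b => Complex.I • X b) ĉ‖
              ≤ CD₁ * ((F.L : ℝ) ^ (K - n))⁻¹ * (∑ b : PBond (F.P K) 0, ‖X b‖ ^ 2) + CD₂ * ((F.L : ℝ) ^ (K - n)) * ((∑ p : Plaq (F.P K) 0, ‖((Complex.I • X ⟨p.src, p.μ⟩) + ((W ⟨p.src, p.μ⟩ : Matrix (Fin 2) (Fin 2) ℂ) * (Complex.I • X ⟨p.src.shift p.μ, p.ν⟩) * star (W ⟨p.src, p.μ⟩ : Matrix (Fin 2) (Fin 2) ℂ))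
            - (((W ⟨p.src, p.μ⟩ * W ⟨p.src.shift p.μ, p.ν⟩ * (W ⟨p.src.shift p.ν, p.μ⟩)⁻¹ : Matrix.specialUnitaryGroup (Fin 2) ℂ) : Matrix (Fin 2) (Fin 2) ℂ) * (Complex.I • X ⟨p.src.shift p.ν, p.μ⟩) * star ((W ⟨p.src, p.μ⟩ * W ⟨p.src.shift p.μ, p.ν⟩ * (W ⟨p.src.shift p.ν, p.μ⟩)⁻¹ : Matrix.specialUnitaryGroup (Fin 2) ℂ) : Matrix (Fin 2) (Fin 2) ℂ))
            - (((GaugeField.plaqHol W p : Matrix.specialUnitaryGroup (Fin 2) ℂ) : Matrix (Fin 2) (Fin 2) ℂ) * (Complex.I • X ⟨p.src, p.ν⟩) * star ((GaugeField.plaqHol W p : Matrix.specialUnitaryGroup (Fin 2) ℂ) : Matrix (Fin 2) (Fin 2) ℂ)))‖ ^ 2) + (∑ x : Site (F.P K) 0, ∑ j : Fin 2, ∑ k : Fin 2,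
              ‖(divB (torusT (F.P K) 0) (fun κ z => unitsField (toUField W) ⟨z, κ⟩) (fun κ z => Complex.I • X ⟨z, κ⟩) x) j k‖ ^ 2)))
    (hV : ∀ (L : ℕ), 1 < L → ∀ (B₁' : ℝ), 0 < B₁' → ∃ eV ζ δ₁ : ℝ, 0 < eV ∧ 0 ≤ ζ ∧ 0 ≤ δ₁ ∧
      ∀ (F : T3Family), F.L = L → ∀ (n K : ℕ) (hnK : n < K) (e : ℝ) (V : GaugeField (F.P n) 0 (Matrix.specialUnitaryGroup (Fin 2) ℂ))
        (W : GaugeField (F.P K) 0 (Matrix.specialUnitaryGroup (Fin 2) ℂ)) (X : PBond (F.P K) 0 → Matrix (Fin 2) (Fin 2) ℂ),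
        0 < e → e ≤ eV → W ∈ regFibrePr F n K hnK.le e V →
        (∀ γ : ℝ → GaugeField (F.P K) 0 (Matrix.specialUnitaryGroup (Fin 2) ℂ), γ 0 = W → (∀ t, γ t ∈ fibre F ℰp n K hnK.le V) →
          (∀ b, DifferentiableAt ℝ (fun t => ((γ t b : Matrix.specialUnitaryGroup (Fin 2) ℂ) : Matrix (Fin 2) (Fin 2) ℂ)) 0) →
            deriv (fun t => wilsonAction4 (γ t)) 0 = 0) →
        In19 F n K (2 * B₁' * e) W (expHermField X) X → AvgCondPrint F n K hnK.le V W X → IsLandauPrint F n K W X →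
          (∑ x : Site (F.P K) 0, ∑ j : Fin 2, ∑ k : Fin 2,
              ‖(divB (torusT (F.P K) 0) (fun κ z => unitsField (toUField W) ⟨z, κ⟩) (fun κ z => Complex.I • X ⟨z, κ⟩) x) j k‖ ^ 2)
              ≤ ζ * (∑ p : Plaq (F.P K) 0, ‖((Complex.I • X ⟨p.src, p.μ⟩) + ((W ⟨p.src, p.μ⟩ : Matrix (Fin 2) (Fin 2) ℂ) * (Complex.I • X ⟨p.src.shift p.μ, p.ν⟩) * star (W ⟨p.src, p.μ⟩ : Matrix (Fin 2) (Fin 2) ℂ))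
            - (((W ⟨p.src, p.μ⟩ * W ⟨p.src.shift p.μ, p.ν⟩ * (W ⟨p.src.shift p.ν, p.μ⟩)⁻¹ : Matrix.specialUnitaryGroup (Fin 2) ℂ) : Matrix (Fin 2) (Fin 2) ℂ) * (Complex.I • X ⟨p.src.shift p.ν, p.μ⟩) * star ((W ⟨p.src, p.μ⟩ * W ⟨p.src.shift p.μ, p.ν⟩ * (W ⟨p.src.shift p.ν, p.μ⟩)⁻¹ : Matrix.specialUnitaryGroup (Fin 2) ℂ) : Matrix (Fin 2) (Fin 2) ℂ))
            - (((GaugeField.plaqHol W p : Matrix.specialUnitaryGroup (Fin 2) ℂ) : Matrix (Fin 2) (Fin 2) ℂ) * (Complex.I • X ⟨p.src, p.ν⟩) * star ((GaugeField.plaqHol W p : Matrix.specialUnitaryGroup (Fin 2) ℂ) : Matrix (Fin 2) (Fin 2) ℂ)))‖ ^ 2) + δ₁ * (((F.L : ℝ) ^ (K - n)) ^ 2)⁻¹ * (∑ b : PBond (F.P K) 0, ‖X b‖ ^ 2)) :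
    ∀ (L : ℕ), 1 < L → ∀ (B₁' : ℝ), 0 < B₁' → ∃ eJ C₁ C₂ ζ δ₁ : ℝ, 0 < eJ ∧ 0 ≤ C₁ ∧ 0 ≤ C₂ ∧ 0 ≤ ζ ∧ 0 ≤ δ₁ ∧
      ∀ (F : T3Family), F.L = L → ∀ (n K : ℕ) (hnK : n < K) (e : ℝ) (V : GaugeField (F.P n) 0 (Matrix.specialUnitaryGroup (Fin 2) ℂ))
        (W : GaugeField (F.P K) 0 (Matrix.specialUnitaryGroup (Fin 2) ℂ)) (X : PBond (F.P K) 0 → Matrix (Fin 2) (Fin 2) ℂ),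
        0 < e → e ≤ eJ → W ∈ regFibrePr F n K hnK.le e V →
        (∀ γ : ℝ → GaugeField (F.P K) 0 (Matrix.specialUnitaryGroup (Fin 2) ℂ), γ 0 = W → (∀ t, γ t ∈ fibre F ℰp n K hnK.le V) →
          (∀ b, DifferentiableAt ℝ (fun t => ((γ t b : Matrix.specialUnitaryGroup (Fin 2) ℂ) : Matrix (Fin 2) (Fin 2) ℂ)) 0) →
            deriv (fun t => wilsonAction4 (γ t)) 0 = 0) →
        In19 F n K (2 * B₁' * e) W (expHermField X) X → AvgCondPrint F n K hnK.le V W X → IsLandauPrint F n K W X →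
          ∃ dv : ℝ, ∑ ĉ : PBond (F.P n) 0, ‖CmapTw F n K hnK.le W (fun b => Complex.I • X b) ĉ‖
              ≤ C₁ * ((F.L : ℝ) ^ (K - n))⁻¹ * (∑ b : PBond (F.P K) 0, ‖X b‖ ^ 2) + C₂ * ((F.L : ℝ) ^ (K - n)) * ((∑ p : Plaq (F.P K) 0, ‖((Complex.I • X ⟨p.src, p.μ⟩) + ((W ⟨p.src, p.μ⟩ : Matrix (Fin 2) (Fin 2) ℂ) * (Complex.I • X ⟨p.src.shift p.μ, p.ν⟩) * star (W ⟨p.src, p.μ⟩ : Matrix (Fin 2) (Fin 2) ℂ))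
            - (((W ⟨p.src, p.μ⟩ * W ⟨p.src.shift p.μ, p.ν⟩ * (W ⟨p.src.shift p.ν, p.μ⟩)⁻¹ : Matrix.specialUnitaryGroup (Fin 2) ℂ) : Matrix (Fin 2) (Fin 2) ℂ) * (Complex.I • X ⟨p.src.shift p.ν, p.μ⟩) * star ((W ⟨p.src, p.μ⟩ * W ⟨p.src.shift p.μ, p.ν⟩ * (W ⟨p.src.shift p.ν, p.μ⟩)⁻¹ : Matrix.specialUnitaryGroup (Fin 2) ℂ) : Matrix (Fin 2) (Fin 2) ℂ))
            - (((GaugeField.plaqHol W p : Matrix.specialUnitaryGroup (Fin 2) ℂ) : Matrix (Fin 2) (Fin 2) ℂ) * (Complex.I • X ⟨p.src, p.ν⟩) * star ((GaugeField.plaqHol W p : Matrix.specialUnitaryGroup (Fin 2) ℂ) : Matrix (Fin 2) (Fin 2) ℂ)))‖ ^ 2) + dv) ∧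
            dv ≤ ζ * (∑ p : Plaq (F.P K) 0, ‖((Complex.I • X ⟨p.src, p.μ⟩) + ((W ⟨p.src, p.μ⟩ : Matrix (Fin 2) (Fin 2) ℂ) * (Complex.I • X ⟨p.src.shift p.μ, p.ν⟩) * star (W ⟨p.src, p.μ⟩ : Matrix (Fin 2) (Fin 2) ℂ))
            - (((W ⟨p.src, p.μ⟩ * W ⟨p.src.shift p.μ, p.ν⟩ * (W ⟨p.src.shift p.ν, p.μ⟩)⁻¹ : Matrix.specialUnitaryGroup (Fin 2) ℂ) : Matrix (Fin 2) (Fin 2) ℂ) * (Complex.I • X ⟨p.src.shift p.ν, p.μ⟩) * star ((W ⟨p.src, p.μ⟩ * W ⟨p.src.shift p.μ, p.ν⟩ * (W ⟨p.src.shift p.ν, p.μ⟩)⁻¹ : Matrix.specialUnitaryGroup (Fin 2) ℂ) : Matrix (Fin 2) (Fin 2) ℂ))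
            - (((GaugeField.plaqHol W p : Matrix.specialUnitaryGroup (Fin 2) ℂ) : Matrix (Fin 2) (Fin 2) ℂ) * (Complex.I • X ⟨p.src, p.ν⟩) * star ((GaugeField.plaqHol W p : Matrix.specialUnitaryGroup (Fin 2) ℂ) : Matrix (Fin 2) (Fin 2) ℂ)))‖ ^ 2) + δ₁ * (((F.L : ℝ) ^ (K - n)) ^ 2)⁻¹ * (∑ b : PBond (F.P K) 0, ‖X b‖ ^ 2) := by
  intro L hL B₁' hB₁'
  obtain ⟨eS, CS₁, CS₂, heS, hCS₁, hCS₂, HS⟩ := hS L hL B₁' hB₁'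
  obtain ⟨eD, CD₁, CD₂, heD, hCD₁, hCD₂, HD⟩ := hD L hL B₁' hB₁'
  obtain ⟨eV, ζ, δ₁, heV, hζ, hδ₁, HV⟩ := hV L hL B₁' hB₁'
  refine ⟨min eS (min eD eV), CS₁ + CD₁, CS₂ + CD₂, ζ, δ₁, lt_min heS (lt_min heD heV), by positivity, by positivity, hζ, hδ₁, ?_⟩
  intro F hF n K hnK e V W X he heε hWreg hEL h19 h20 h21
  have h1 := HS F hF n K hnK e V W X he (heε.trans (min_le_left _ _)) hWreg hEL h19 h20 h21
  have h2 := HD F hF n K hnK e V W X he ((heε.trans (min_le_right _ _)).trans (min_le_left _ _)) hWreg hEL h19 h20 h21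
  have h3 := HV F hF n K hnK e V W X he ((heε.trans (min_le_right _ _)).trans (min_le_right _ _)) hWreg hEL h19 h20 h21
  refine ⟨_, ?_, h3⟩
  -- `Σ‖C ĉ‖ ≤ Σ‖C_S ĉ‖ + Σ‖C ĉ − C_S ĉ‖`, then add the two rows
  have htri : ∑ ĉ : PBond (F.P n) 0, ‖CmapTw F n K hnK.le W (fun b => Complex.I • X b) ĉ‖
      ≤ ∑ ĉ : PBond (F.P n) 0, ‖CmapTwS F n K hnK.le W (fun b => Complex.I • X b) ĉ‖
        + ∑ ĉ : PBond (F.P n) 0, ‖CmapTw F n K hnK.le W (fun b => Complex.I • X b) ĉ - CmapTwS F n K hnK.le W (fun b => Complex.I • X b) ĉ‖ := by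
    rw [← Finset.sum_add_distrib]
    exact Finset.sum_le_sum fun ĉ _ => norm_le_insert' _ _
  have hsum := htri.trans (add_le_add h1 h2)
  have heq : CS₁ * ((F.L : ℝ) ^ (K - n))⁻¹ * (∑ b : PBond (F.P K) 0, ‖X b‖ ^ 2) + CS₂ * ((F.L : ℝ) ^ (K - n)) * ((∑ p : Plaq (F.P K) 0, ‖((Complex.I • X ⟨p.src, p.μ⟩) + ((W ⟨p.src, p.μ⟩ : Matrix (Fin 2) (Fin 2) ℂ) * (Complex.I • X ⟨p.src.shift p.μ, p.ν⟩) * star (W ⟨p.src, p.μ⟩ : Matrix (Fin 2) (Fin 2) ℂ))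
            - (((W ⟨p.src, p.μ⟩ * W ⟨p.src.shift p.μ, p.ν⟩ * (W ⟨p.src.shift p.ν, p.μ⟩)⁻¹ : Matrix.specialUnitaryGroup (Fin 2) ℂ) : Matrix (Fin 2) (Fin 2) ℂ) * (Complex.I • X ⟨p.src.shift p.ν, p.μ⟩) * star ((W ⟨p.src, p.μ⟩ * W ⟨p.src.shift p.μ, p.ν⟩ * (W ⟨p.src.shift p.ν, p.μ⟩)⁻¹ : Matrix.specialUnitaryGroup (Fin 2) ℂ) : Matrix (Fin 2) (Fin 2) ℂ))
            - (((GaugeField.plaqHol W p : Matrix.specialUnitaryGroup (Fin 2) ℂ) : Matrix (Fin 2) (Fin 2) ℂ) * (Complex.I • X ⟨p.src, p.ν⟩) * star ((GaugeField.plaqHol W p : Matrix.specialUnitaryGroup (Fin 2) ℂ) : Matrix (Fin 2) (Fin 2) ℂ)))‖ ^ 2) + (∑ x : Site (F.P K) 0, ∑ j : Fin 2, ∑ k : Fin 2,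
              ‖(divB (torusT (F.P K) 0) (fun κ z => unitsField (toUField W) ⟨z, κ⟩) (fun κ z => Complex.I • X ⟨z, κ⟩) x) j k‖ ^ 2))
      + (CD₁ * ((F.L : ℝ) ^ (K - n))⁻¹ * (∑ b : PBond (F.P K) 0, ‖X b‖ ^ 2) + CD₂ * ((F.L : ℝ) ^ (K - n)) * ((∑ p : Plaq (F.P K) 0, ‖((Complex.I • X ⟨p.src, p.μ⟩) + ((W ⟨p.src, p.μ⟩ : Matrix (Fin 2) (Fin 2) ℂ) * (Complex.I • X ⟨p.src.shift p.μ, p.ν⟩) * star (W ⟨p.src, p.μ⟩ : Matrix (Fin 2) (Fin 2) ℂ))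
            - (((W ⟨p.src, p.μ⟩ * W ⟨p.src.shift p.μ, p.ν⟩ * (W ⟨p.src.shift p.ν, p.μ⟩)⁻¹ : Matrix.specialUnitaryGroup (Fin 2) ℂ) : Matrix (Fin 2) (Fin 2) ℂ) * (Complex.I • X ⟨p.src.shift p.ν, p.μ⟩) * star ((W ⟨p.src, p.μ⟩ * W ⟨p.src.shift p.μ, p.ν⟩ * (W ⟨p.src.shift p.ν, p.μ⟩)⁻¹ : Matrix.specialUnitaryGroup (Fin 2) ℂ) : Matrix (Fin 2) (Fin 2) ℂ))
            - (((GaugeField.plaqHol W p : Matrix.specialUnitaryGroup (Fin 2) ℂ) : Matrix (Fin 2) (Fin 2) ℂ) * (Complex.I • X ⟨p.src, p.ν⟩) * star ((GaugeField.plaqHol W p : Matrix.specialUnitaryGroup (Fin 2) ℂ) : Matrix (Fin 2) (Fin 2) ℂ)))‖ ^ 2) + (∑ x : Site (F.P K) 0, ∑ j : Fin 2, ∑ k : Fin 2,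
              ‖(divB (torusT (F.P K) 0) (fun κ z => unitsField (toUField W) ⟨z, κ⟩) (fun κ z => Complex.I • X ⟨z, κ⟩) x) j k‖ ^ 2)))
      = (CS₁ + CD₁) * ((F.L : ℝ) ^ (K - n))⁻¹ * (∑ b : PBond (F.P K) 0, ‖X b‖ ^ 2) + (CS₂ + CD₂) * ((F.L : ℝ) ^ (K - n)) * ((∑ p : Plaq (F.P K) 0, ‖((Complex.I • X ⟨p.src, p.μ⟩) + ((W ⟨p.src, p.μ⟩ : Matrix (Fin 2) (Fin 2) ℂ) * (Complex.I • X ⟨p.src.shift p.μ, p.ν⟩) * star (W ⟨p.src, p.μ⟩ : Matrix (Fin 2) (Fin 2) ℂ))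
            - (((W ⟨p.src, p.μ⟩ * W ⟨p.src.shift p.μ, p.ν⟩ * (W ⟨p.src.shift p.ν, p.μ⟩)⁻¹ : Matrix.specialUnitaryGroup (Fin 2) ℂ) : Matrix (Fin 2) (Fin 2) ℂ) * (Complex.I • X ⟨p.src.shift p.ν, p.μ⟩) * star ((W ⟨p.src, p.μ⟩ * W ⟨p.src.shift p.μ, p.ν⟩ * (W ⟨p.src.shift p.ν, p.μ⟩)⁻¹ : Matrix.specialUnitaryGroup (Fin 2) ℂ) : Matrix (Fin 2) (Fin 2) ℂ))
            - (((GaugeField.plaqHol W p : Matrix.specialUnitaryGroup (Fin 2) ℂ) : Matrix (Fin 2) (Fin 2) ℂ) * (Complex.I • X ⟨p.src, p.ν⟩) * star ((GaugeField.plaqHol W p : Matrix.specialUnitaryGroup (Fin 2) ℂ) : Matrix (Fin 2) (Fin 2) ℂ)))‖ ^ 2) + (∑ x : Site (F.P K) 0, ∑ j : Fin 2, ∑ k : Fin 2,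
              ‖(divB (torusT (F.P K) 0) (fun κ z => unitsField (toUField W) ⟨z, κ⟩) (fun κ z => Complex.I • X ⟨z, κ⟩) x) j k‖ ^ 2)) := by ring
  rw [heq] at hsum
  exact hsum

end Summit.QuantumFields.YangMills.Theorems.Prop7PA2OfSymDiffDivRows

end
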